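import Summits.HubbardSuperconductivity.HubbardSuperconductivity.Theses.ChiralWindow
import Summits.HubbardSuperconductivity.HubbardSuperconductivity.Theses.WeakCouplingBCS
import Summits.HubbardSuperconductivity.HubbardSuperconductivity.Theses.KacWindowPenalty
import Literature.MathematicalPhysics.QuantumLattice.DWaveSource
import Literature.MathematicalPhysics.QuantumLattice.PairCorrelations

/-!
# Sketch — crux idea `no-kink-griffiths-slope` for `CwSsbToEvenTorusLRO` (stmt-HubbardSuperconductivity-10439)

Two-parameter Griffiths slope transfer. With `K_μ = hubbardTorusWith 2 L 1 U μ`, the d-wave pair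
field `P = pairField dWaveFormFactor L`, the sourced Hamiltonian `T_h = K_μ - h(P + Pᴴ)`
(`dWaveSourceTorus`) and the Kac block operator `W_R = R⁻⁴ Σ_a B_aᴴ B_a`
(`B_a = Σ_{u ∈ [0,R)²} P_{a+u}`, the convention of `Lines/tangent-face-legendre-spine.lean` of the twin
crux stmt-2009), put `E_L(h, κ) := groundEnergy (T_h + κ W_R)` (jointly concave in `(h, κ)`).

* `GriffithsBlockSlope` (FIRST LEMMA, provable now): for `κ ≤ 0`,
  `E_L(h,κ) - E_L(h,0) ≤ κ · L² · (dWaveSourceDensity L U μ h)²` — variational principle with each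
  sourced ground state, `⟨W_R⟩ ≥ ‖Pφ‖²/L² ≥ (Re⟨φ,Pφ⟩)²/L²` (Σ_a B_a = R²P, Cauchy–Schwarz twice),
  and `max_i x_i² ≥ (avg_i x_i)²` for the tracial functional.
* `AttractiveBlockGain` (provable from the first lemma): `HasDWaveOrder U μ` alone gives, at `h = 0`,
  `E_L(0,κ) - E_L(0,0) ≤ (κ m² + ε) L²` eventually in `L`, for every `κ < 0` and every block scale
  `R` (`m = dWaveOrderParameter U μ`; the passage `h → 0` costs only `|E_L(h,κ) - E_L(0,κ)| ≤ 2h‖P‖`).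
* `NoBlockKink U μ` (THE OPEN STUB, qualitative): the symmetric second difference of
  `κ ↦ E_L(0,κ)` at `κ = 0` is `o(κ) L²` — differentiability of the grand-canonical ground-energy
  density in the U(1)-invariant block direction (Gibbs phase rule: `κ = 0` is not a first-order point).
* `CanonicalGCEquivalence U δ μ` (verbatim Disproof §12 of the twin crux; thermodynamic-limit work,
  to be used UNDER density matching, Disproof §12b).
* `FacePurityChordOfNoKink`: the three give the twin line's last open stub `stub_facePurityChord`
  with the SHARP floor `a = m² - ε` (chord form), hence block coherence `≥ m² - ε` of EVERY sector
  ground state by the tree's `chord_div_le_re_expect_of_eigen`, and the crux by the LANDED Fejér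
  closure + `KacWindowPenalty.WindowInfraredBound` (stmt-1089) exactly as in
  `Lines/tangent-face-legendre-spine.lean` (`crux_body_of_face_leak_fejer`), since
  `CwSsbToEvenTorusLRO ↔ WcbcsSsbToTorusLRO` is `Iff.rfl` (`cw_iff_wcbcs` below).
-/

noncomputable section

set_option linter.dupNamespace false

namespace Summit.HubbardSuperconductivity.HubbardSuperconductivity.Cruxes.CwSsbToEvenTorusLRO.NoKinkGriffithsSlope

open Literature.MathematicalPhysics.QuantumLattice Literature.Probability.LatticeModels
open Filter Set
open scoped Matrix ComplexOrder BigOperators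
open _root_.Topology

/-- The twin relation: this crux IS `WeakCouplingBCS.WcbcsSsbToTorusLRO` (stmt-2009). -/
theorem cw_iff_wcbcs :
    Summit.HubbardSuperconductivity.HubbardSuperconductivity.Theses.ChiralWindow.CwSsbToEvenTorusLRO ↔
      Summit.HubbardSuperconductivity.HubbardSuperconductivity.Theses.WeakCouplingBCS.WcbcsSsbToTorusLRO :=
  Iff.rfl

section Blocks

variable (L : ℕ) [NeZero L]

/-- Kac block pair operator `B_a = Σ_{u ∈ [0,R)²} P_{a+u}` (d-wave local pairs), tangent-face convention. -/
def blockPair (R : ℕ) (a : TorusSite 2 L) :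
    Matrix (Finset (Orb (FermionTorus 2 L))) (Finset (Orb (FermionTorus 2 L))) ℂ :=
  ∑ u : Fin 2 → Fin R, localPair dWaveFormFactor L (a + fun i => ((u i : ℕ) : ZMod L))

/-- The block operator `W_R = R⁻⁴ Σ_a B_aᴴ B_a` (positive, U(1)-invariant, translation invariant,
finite range `2R`); `⟨φ, W_R φ⟩ / L²` is the block pair coherence `BC_R(φ)`. -/
def blockOp (R : ℕ) : Matrix (Finset (Orb (FermionTorus 2 L))) (Finset (Orb (FermionTorus 2 L))) ℂ :=
  ((((R : ℝ) ^ 4)⁻¹ : ℝ) : ℂ) • ∑ a : TorusSite 2 L, (blockPair L R a)ᴴ * blockPair L R a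

/-- The two-parameter sourced, block-perturbed ground energy `E_L(h, κ) = E₀(K_μ - h(P+Pᴴ) + κ W_R)`. -/
def sourcedBlockEnergy (R : ℕ) (U μ h κ : ℝ) : ℝ :=
  (dWaveSourceTorus L U μ h + (κ : ℂ) • blockOp L R).groundEnergy

end Blocks

/-- **Block coherence dominates the squared pair amplitude** (finite `L`, provable now):
`Re⟨φ, W_R φ⟩ ≥ (Re⟨φ, P φ⟩)² / L²` for a unit vector, from `Σ_a B_a = R² P` and Cauchy–Schwarz twice. -/
def BlockCoherenceDominatesOrder : Prop :=
  ∀ (L : ℕ) [NeZero L] (R : ℕ), 0 < R → ∀ φ : Fock (Orb (FermionTorus 2 L)), star φ ⬝ᵥ φ = 1 →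
    (star φ ⬝ᵥ pairField dWaveFormFactor L *ᵥ φ).re ^ 2 / (L : ℝ) ^ 2 ≤
      (star φ ⬝ᵥ blockOp L R *ᵥ φ).re

/-- **FIRST LEMMA `GriffithsBlockSlope`** (finite `L`, provable now, ~300 lines): on the attractive side
`κ ≤ 0` the block perturbation lowers the SOURCED ground energy at rate at least the squared sourced
order density: `E_L(h,κ) - E_L(h,0) ≤ κ · L² · (dWaveSourceDensity L U μ h)²`. Proof: variational
principle `groundEnergy (T_h + κW) ≤ Re⟨φ_i,(T_h + κW)φ_i⟩ = E_L(h,0) + κ Re⟨φ_i, W φ_i⟩` for each member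
`φ_i` of an orthonormal basis of the ground space of `T_h = dWaveSourceTorus L U μ h`;
`BlockCoherenceDominatesOrder`; `κ ≤ 0`; and `max_i x_i² ≥ (avg_i x_i)²` with
`avg_i Re⟨φ_i, P φ_i⟩ = L² · dWaveSourceDensity L U μ h` (`groundStateFunctional` is the tracial average). -/
def GriffithsBlockSlope : Prop :=
  ∀ (L : ℕ) [NeZero L] (R : ℕ), 0 < R → ∀ (U μ h κ : ℝ), κ ≤ 0 →
    sourcedBlockEnergy L R U μ h κ - sourcedBlockEnergy L R U μ h 0 ≤
      κ * (L : ℝ) ^ 2 * dWaveSourceDensity L U μ h ^ 2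

/-- **`AttractiveBlockGain`** (provable from `GriffithsBlockSlope` + unpacking the two `liminf`s of
`dWaveOrderParameter` + `|E_L(h,κ) - E_L(0,κ)| ≤ 2h‖P‖ ≤ 2h·C_d·L²`): Koma–Tasaki d-wave order ALONE
forces, at zero source, an attractive-side slope of the GC ground energy in EVERY block direction of at
least `m²`: for `κ < 0`, `E_L(0,κ) - E_L(0,0) ≤ (κ m² + ε) L²` eventually in `L`. -/
def AttractiveBlockGain : Prop :=
  ∀ (U μ : ℝ), HasDWaveOrder U μ → ∀ (R : ℕ), 0 < R → ∀ κ : ℝ, κ < 0 → ∀ ε : ℝ, 0 < ε →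
    ∀ᶠ L : ℕ in atTop,
      sourcedBlockEnergy (L + 1) R U μ 0 κ - sourcedBlockEnergy (L + 1) R U μ 0 0 ≤
        (κ * dWaveOrderParameter U μ ^ 2 + ε) * ((L + 1 : ℕ) : ℝ) ^ 2

/-- **THE OPEN STUB `NoBlockKink U μ`** (qualitative; "κ = 0 is not a first-order transition point of
the source-free grand-canonical model in the block-pair direction `W_R`"): the symmetric second
difference of `κ ↦ E_L(0, κ)` at `0` is `o(κ)·L²`, i.e. right slope = left slope of the GC ground-energy
density at `κ = 0`, for every block scale `R` (one sufficiently large `R` would do). Concavity gives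
`≤ 0` for free; this is the `≥ -εκL²` half. -/
def NoBlockKink (U μ : ℝ) : Prop :=
  ∀ (R : ℕ), 0 < R → ∀ ε : ℝ, 0 < ε → ∃ κ : ℝ, 0 < κ ∧
    ∀ᶠ L : ℕ in atTop,
      -(ε * κ) * ((L + 1 : ℕ) : ℝ) ^ 2 ≤
        sourcedBlockEnergy (L + 1) R U μ 0 κ + sourcedBlockEnergy (L + 1) R U μ 0 (-κ)
          - 2 * sourcedBlockEnergy (L + 1) R U μ 0 0

/-- `CanonicalGCEquivalence U δ μ` — verbatim §12 of the twin's `Disproof.lean`: along even sides the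
source-free canonical sector energy at `N_L = 2⌊(1-δ)L²/2⌋`, shifted by `-μN_L`, is within `o(L²)` of the
grand-canonical ground energy `E₀(K_μ)`. FALSE as a bare `Prop` in `μ` (Disproof §12b
`seededRecentring_false_without_densityMatching` pattern): to be used only UNDER density matching. -/
def CanonicalGCEquivalence (U δ μ : ℝ) : Prop :=
  ∀ ε : ℝ, 0 < ε → ∃ L₀ : ℕ, ∀ (L : ℕ) [NeZero L], L₀ ≤ L → Even L →
    (∃ φ : Fock (Orb (FermionTorus 2 L)), φ ∈ szSector (2 * ⌊(1 - δ) * (L : ℝ) ^ 2 / 2⌋₊) 0 ∧ φ ≠ 0) →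
      (hubbardTorus 2 L 1 U).minEnergyOn (szSector (2 * ⌊(1 - δ) * (L : ℝ) ^ 2 / 2⌋₊) 0) -
          μ * ((2 * ⌊(1 - δ) * (L : ℝ) ^ 2 / 2⌋₊ : ℕ) : ℝ) - (hubbardTorusWith 2 L 1 U μ).groundEnergy ≤
        ε * (L : ℝ) ^ 2

/-- Density matching (the crux's first antecedent), named. -/
def DensityMatched (U δ μ : ℝ) : Prop :=
  Filter.Tendsto (fun L : ℕ => ((hubbardTorusWith 2 (L + 1) 1 U μ).groundStateFunctional totalNumber).re /
    ((L + 1 : ℕ) : ℝ) ^ 2) Filter.atTop (nhds (1 - δ))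

/-- **`FacePurityChordOfNoKink`** (the composition this line owes, provable from `AttractiveBlockGain`,
`E_sec(H + κW_R) - μN_L ≥ E₀(K_μ + κW_R)` (trivial) and the definitions): order + no kink + canonical/GC
touching give the CHORD form of face purity with the sharp floor `m² - ε` — i.e. the twin line's last
open stub `stub_facePurityChord` with `a := m²/2`, every sector ground state then inheriting block
coherence `≥ m²/2` through `chord_div_le_re_expect_of_eigen`. -/
def FacePurityChordOfNoKink : Prop :=
  ∀ (U δ μ : ℝ), DensityMatched U δ μ → HasDWaveOrder U μ → NoBlockKink U μ →
    CanonicalGCEquivalence U δ μ →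
    ∀ (R : ℕ), 0 < R → ∀ ε : ℝ, 0 < ε → ∃ κ : ℝ, 0 < κ ∧ ∀ᶠ k : ℕ in Filter.atTop,
      κ * (dWaveOrderParameter U μ ^ 2 - ε) * ((2 * k + 1 + 1 : ℕ) : ℝ) ^ 2 ≤
        (hubbardTorus 2 (2 * k + 1 + 1) 1 U + (κ : ℂ) • blockOp (2 * k + 1 + 1) R).minEnergyOn
            (szSector (2 * ⌊(1 - δ) * ((2 * k + 1 + 1 : ℕ) : ℝ) ^ 2 / 2⌋₊) 0) -
          (hubbardTorus 2 (2 * k + 1 + 1) 1 U).minEnergyOn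
            (szSector (2 * ⌊(1 - δ) * ((2 * k + 1 + 1 : ℕ) : ℝ) ^ 2 / 2⌋₊) 0)

/-- **Transfer `C⁺`** of the card: in the weak-coupling window, no block kink and canonical/GC touching
at every density-matched, ordered parameter. -/
def Transfer : Prop :=
  ∃ U₀ : ℝ, 0 < U₀ ∧ ∀ U ∈ Set.Ioo (0:ℝ) U₀, ∀ δ ∈ Set.Ioo (0:ℝ) (1 / 2), ∀ μ : ℝ,
    DensityMatched U δ μ → HasDWaveOrder U μ → NoBlockKink U μ ∧ CanonicalGCEquivalence U δ μ

/-- **Shape of the closing implication** (the crux-plan's `CwSsbToEvenTorusLRO_of`): the transfer `C⁺`,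
the composition `FacePurityChordOfNoKink`, the existing open item `KacWindowPenalty.WindowInfraredBound`
(stmt-1089, the infrared window) and the landed Fejér closure conclude the crux BY NAME — typed here as a
`Prop` (the proof is the twin's `crux_body_of_face_leak_fejer` with `a := m²/2`, then `cw_iff_wcbcs`). -/
def ClosingShape : Prop :=
  Transfer → FacePurityChordOfNoKink →
    Summit.HubbardSuperconductivity.HubbardSuperconductivity.Theses.KacWindowPenalty.WindowInfraredBound →
      Summit.HubbardSuperconductivity.HubbardSuperconductivity.Theses.ChiralWindow.CwSsbToEvenTorusLRO


/-! ### Transfer B: order that survives SOME block repulsion `κ₀ > 0` (no differentiability at all)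

Concavity of `κ ↦ E_L(0,κ)` gives `chord[0,κ₀] ≥ chord[κ₀ - t, κ₀]`, and `GriffithsBlockSlope` at the
REPELLED base Hamiltonian `K_μ + κ₀W_R` bounds the latter chord from below by `L²·(sourced order density
of the repelled model)²`. So Koma–Tasaki d-wave order of `K_μ + κ₀ W_R` for ONE `κ₀ > 0` already forces
block coherence `≥ m_R(κ₀)² - ε` of every source-free sector ground state of `H` — the crux's own
hypothesis (order at `κ = 0`) is then only the necessary condition `m_R(κ₀) ≤ m(0) + o(1)` (usc). -/

section Repelled

variable (L : ℕ) [NeZero L]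

/-- Sourced order density of the block-REPELLED model: `Re ω₀(P)/L²` in the ground state(s) of
`K_μ - h(P+Pᴴ) + κ W_R`. At `κ = 0` this is `dWaveSourceDensity L U μ h`. -/
def repelledSourceDensity (R : ℕ) (κ U μ h : ℝ) : ℝ :=
  ((dWaveSourceTorus L U μ h + (κ : ℂ) • blockOp L R).groundStateFunctional
      (pairField dWaveFormFactor L)).re / (L : ℝ) ^ 2

end Repelled

/-- Koma–Tasaki d-wave order parameter of the block-repelled model (`L → ∞` first, then `h ↓ 0`). -/
def repelledOrderParameter (R : ℕ) (κ U μ : ℝ) : ℝ :=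
  liminf (fun h : ℝ => liminf (fun L : ℕ => repelledSourceDensity (L + 1) R κ U μ h) atTop) (𝓝[>] 0)

/-- **THE ALTERNATIVE OPEN STUB `RepelledOrderPersistence U μ`**: for every block scale `R` there is a
repulsive block coupling `κ₀ > 0` at which the model STILL has Koma–Tasaki d-wave order (any positive
amount; the amount is the floor handed to the conclusion). A robustness statement of the same type as the
route's construction crux (CwChiralConstruction), for a perturbed Hamiltonian; physically automatic in a
genuine superconducting phase for `κ₀` below a threshold (BCS: the penalty `κ₀L²m²` closes the gap only
beyond `κ_c ≍ g_eff ≍ U²`) and false exactly at equal-energy coexistence with a NON-superconducting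
competitor. -/
def RepelledOrderPersistence (U μ : ℝ) : Prop :=
  ∀ (R : ℕ), 0 < R → ∃ κ : ℝ, 0 < κ ∧ 0 < repelledOrderParameter R κ U μ

/-- `GriffithsBlockSlope` at a repelled base point (same proof as the first lemma, with
`dWaveSourceTorus L U μ h + κ₀ • W_R` as the sourced Hamiltonian): for `t ≥ 0`,
`E_L(h, κ₀ - t) - E_L(h, κ₀) ≤ -t · L² · (repelledSourceDensity L R κ₀ U μ h)²`. -/
def GriffithsBlockSlopeRepelled : Prop :=
  ∀ (L : ℕ) [NeZero L] (R : ℕ), 0 < R → ∀ (U μ h κ₀ t : ℝ), 0 ≤ t →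
    sourcedBlockEnergy L R U μ h (κ₀ - t) - sourcedBlockEnergy L R U μ h κ₀ ≤
      -t * (L : ℝ) ^ 2 * repelledSourceDensity L R κ₀ U μ h ^ 2

/-- **`FacePurityChordOfRepelledOrder`** (provable from `GriffithsBlockSlopeRepelled`, finite-`L`
concavity of `κ ↦ E_L(0,κ)`, `|E_L(h,κ) - E_L(0,κ)| ≤ 2h‖P‖`, the trivial `E_sec - μN_L ≥ E₀^{GC}` and
`CanonicalGCEquivalence`): the chord form of face purity with floor `m_R(κ₀)² - ε`, WITHOUT any
differentiability input. -/
def FacePurityChordOfRepelledOrder : Prop :=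
  ∀ (U δ μ : ℝ), DensityMatched U δ μ → RepelledOrderPersistence U μ → CanonicalGCEquivalence U δ μ →
    ∀ (R : ℕ), 0 < R → ∃ κ : ℝ, 0 < κ ∧ 0 < repelledOrderParameter R κ U μ ∧ ∀ ε : ℝ, 0 < ε →
      ∀ᶠ k : ℕ in Filter.atTop,
        κ * (repelledOrderParameter R κ U μ ^ 2 - ε) * ((2 * k + 1 + 1 : ℕ) : ℝ) ^ 2 ≤
          (hubbardTorus 2 (2 * k + 1 + 1) 1 U + (κ : ℂ) • blockOp (2 * k + 1 + 1) R).minEnergyOn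
              (szSector (2 * ⌊(1 - δ) * ((2 * k + 1 + 1 : ℕ) : ℝ) ^ 2 / 2⌋₊) 0) -
            (hubbardTorus 2 (2 * k + 1 + 1) 1 U).minEnergyOn
              (szSector (2 * ⌊(1 - δ) * ((2 * k + 1 + 1 : ℕ) : ℝ) ^ 2 / 2⌋₊) 0)

/-- Transfer B of the card. -/
def TransferB : Prop :=
  ∃ U₀ : ℝ, 0 < U₀ ∧ ∀ U ∈ Set.Ioo (0:ℝ) U₀, ∀ δ ∈ Set.Ioo (0:ℝ) (1 / 2), ∀ μ : ℝ,
    DensityMatched U δ μ → HasDWaveOrder U μ → RepelledOrderPersistence U μ ∧ CanonicalGCEquivalence U δ μ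

/-! ### Kernel-checked sign bookkeeping of the line (one side `L`, all energies abstracted to reals)

`Eκ, Emκ, E0` = GC ground energies `E_L(0,κ), E_L(0,-κ), E_L(0,0)`; `Sκ, S0` = sector energies of
`H + κW_R`, `H` at `N_L` shifted by `-μN_L`; `A = L²`. The four inputs are, in order: `AttractiveBlockGain`
at `-κ` (with `ε ↦ εκ`), `NoBlockKink`, the trivial `E_sec - μN_L ≥ E₀^{GC}` at `κ`, and
`CanonicalGCEquivalence` at `κ = 0` (with `ε ↦ εκ`). Output: the chord floor `κ(m² - 3ε)L² ≤ Sκ - S0`,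
i.e. `stub_facePurityChord` of the twin line with `a = m² - 3ε`. -/
theorem chord_floor_bookkeeping {Eκ Emκ E0 Sκ S0 A m ε κ : ℝ}
    (hgain : Emκ - E0 ≤ (-κ * m ^ 2 + ε * κ) * A)
    (hnokink : -(ε * κ) * A ≤ Eκ + Emκ - 2 * E0)
    (hlower : Eκ ≤ Sκ)
    (htouch : S0 - E0 ≤ ε * κ * A) :
    κ * (m ^ 2 - 3 * ε) * A ≤ Sκ - S0 := by
  nlinarith

/-- The `h → 0` step of `AttractiveBlockGain` (one side `L`, abstracted): the sourced slope bound at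
field `h` with density `d ≥ m - ε' ≥ 0`, `κ ≤ 0`, and the Lipschitz bounds `|E(h,·) - E(0,·)| ≤ c·h`
give the zero-source attractive slope bound. -/
theorem attractive_gain_bookkeeping {Ehκ Eh0 E0κ E00 A d m ε' c h κ : ℝ}
    (hslope : Ehκ - Eh0 ≤ κ * A * d ^ 2) (hκ : κ ≤ 0) (hA : 0 ≤ A)
    (hd : m - ε' ≤ d) (hmε : 0 ≤ m - ε')
    (h1 : |Ehκ - E0κ| ≤ c * h) (h2 : |Eh0 - E00| ≤ c * h) :
    E0κ - E00 ≤ κ * A * (m - ε') ^ 2 + 2 * (c * h) := by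
  have hd2 : (m - ε') ^ 2 ≤ d ^ 2 := by nlinarith
  have hκA : κ * A ≤ 0 := mul_nonpos_of_nonpos_of_nonneg hκ hA
  have h3 : κ * A * d ^ 2 ≤ κ * A * (m - ε') ^ 2 := mul_le_mul_of_nonpos_left hd2 hκA
  have h1' := (abs_le.mp h1)
  have h2' := (abs_le.mp h2)
  linarith [h1'.1, h1'.2, h2'.1, h2'.2]

/-- Sign bookkeeping of Transfer B (one side `L`, reals): `Ehb, Eha` = sourced GC energies at field `h`
and block couplings `κ₀`, `κ₀ - t`; `E0b, E0a, E00` = the zero-field ones at `κ₀, κ₀ - t, 0`; `Sb, S0` =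
shifted sector energies at `κ₀, 0`; `A = L²`; `d` = repelled sourced order density at `(h, κ₀)`.
Inputs in order: `GriffithsBlockSlopeRepelled`; the two Lipschitz-in-`h` bounds; finite-`L` CONCAVITY
(`chord[0,κ₀] ≥ chord[κ₀-t,κ₀]`, written multiplied out); `E_sec - μN ≥ E^{GC}` at `κ₀`; touching at `0`.
Output: the chord floor with `m_R(κ₀)`, no differentiability anywhere. -/
theorem repelled_chord_floor_bookkeeping {Ehb Eha E0b E0a E00 Sb S0 A d m ε' c h κ₀ t ε : ℝ}
    (hslope : Eha - Ehb ≤ -t * A * d ^ 2)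
    (h1 : |Ehb - E0b| ≤ c * h) (h2 : |Eha - E0a| ≤ c * h)
    (hconc : t * (E0b - E00) ≥ κ₀ * (E0b - E0a)) (ht : 0 < t) (hκ : 0 < κ₀)
    (hd : m - ε' ≤ d) (hmε : 0 ≤ m - ε') (hA : 0 ≤ A)
    (hlower : E0b ≤ Sb) (htouch : S0 - E00 ≤ ε * κ₀ * A) :
    κ₀ * ((m - ε') ^ 2 * A - 2 * (c * h) / t - ε * A) ≤ Sb - S0 := by
  have hd2 : (m - ε') ^ 2 ≤ d ^ 2 := by nlinarith
  have h3 : t * A * (m - ε') ^ 2 ≤ t * A * d ^ 2 :=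
    mul_le_mul_of_nonneg_left hd2 (mul_nonneg ht.le hA)
  have h1' := abs_le.mp h1
  have h2' := abs_le.mp h2
  -- zero-field chord on [κ₀ - t, κ₀]
  have hz : E0b - E0a ≥ t * A * (m - ε') ^ 2 - 2 * (c * h) := by linarith [h1'.1, h1'.2, h2'.1, h2'.2]
  -- concavity moves it to [0, κ₀]
  have hc : E0b - E00 ≥ κ₀ * (A * (m - ε') ^ 2 - 2 * (c * h) / t) := by
    have e1 : κ₀ * (A * (m - ε') ^ 2 - 2 * (c * h) / t) = κ₀ * (t * A * (m - ε') ^ 2 - 2 * (c * h)) / t := by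
      field_simp
    rw [e1, ge_iff_le, div_le_iff₀ ht]
    have := mul_le_mul_of_nonneg_left hz hκ.le
    nlinarith
  nlinarith

end Summit.HubbardSuperconductivity.HubbardSuperconductivity.Cruxes.CwSsbToEvenTorusLRO.NoKinkGriffithsSlope

end
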